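import Summits.BirchSwinnertonDyer.BirchSwinnertonDyer.Theorems.PrintX8VSCSharpFlatKatoDivisibilityContraOfThm134
import Literature.NumberTheory.EllipticCurves.Kato2004.FineSelmerDualTorsionOfEulerSystemBoundProofs
import Literature.NumberTheory.EllipticCurves.Sprung2012.SharpFlatSelmerTorsionOfContragredientSequenceProofs
import Literature.NumberTheory.EllipticCurves.Sprung2012.SharpFlatSelmerModuleFiniteProofs
import Literature.NumberTheory.EllipticCurves.KatoRankBoundProofs
import Literature.NumberTheory.EllipticCurves.CyclotomicZpExtensionLocalGeneratorProofs
import Summits.BirchSwinnertonDyer.BirchSwinnertonDyer.Theorems.PrintX8VSCSharpFlatKatoUpperHalfContra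
import HarnessLib

/-!
# Sprung 2012 Thm. 7.14 (`X^•(E/ℚ_∞)` finitely generated `Λ`-torsion) and Kato's fine-Selmer torsion (Thm. 12.4 (1) /
# (17.13.1), Kobayashi Cor. 7.2) — DERIVED, on class X8 and for every non-CM curve with `E[p]` irreducible and a `p`-adic
# unit period ratio, from Kato 2004 Thm. 13.4 (print-exact), Serre's open image and the held `γ⁻¹`-keyed Coleman–Kato
# package (sequel of `PrintX8VSCSharpFlatKatoDivisibilityContraOfThm134`: with it, BOTH Sprung theorems of the K′/C′ guard are
# kernel consequences on X8 of {Kato 13.4, Serre, package, period unit})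

Cell `bsd-ssimc` (host), width seat `cruxlead-stmt-BirchSwinnertonDyer-19875-w3` (gen 11) under the LEAD of crux
stmt-BirchSwinnertonDyer-19875 `SprungLowerDivisibilityAtThree`; twin route `PrintX8VSC`. `--supports` stmt-BirchSwinnertonDyer-19875
`--as helper`; THEOREMS ONLY (no `def`, no named fact, no instance); closes NO item.

## What and why

The named fact `Sprung2012.thm714_sharpFlatSelmerDual_finite_torsion` (Sprung 2012 Thm. 1.2 / 7.14: `X^•(E/ℚ_∞)` is a finitely
generated torsion `Λ`-module when `L^• ≠ 0`) is the FIRST antecedent of the guards of K′ (23732) / C′ (23733), conjunct (iii) of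
`PublishedInputsX8Contra` (23741), conjunct (i) of `HeldInputsX8RContra` (23734) and aside `InputSharpFlatTorsion` (20414). The
tree already derives it from the `γ⁻¹`-keyed package (`thm714_sharpFlatSelmerDual_finite_torsion_of_zetaJointContra`), but modulo
two MORE named facts: Kato (12.2.2) (`Kato2004.one_le_rank_iwasawaH1`) and Kato's fine torsion (`Kato2004_fineSelmerDual_isTorsion`,
Thm. 12.4 (1)); the per-curve form `sharpFlatSelmerDual_finite_torsion_of_colemanKatoContra_of_irreducible` still needs the
latter. In print both are corollaries of Kato's Thm. 13.4 (2) at the augmentation prime `(T)` (Kobayashi 2003 Cor. 7.2; the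
tree's `Kato2004.isTorsion_fineSelmerDual_of_thm13_4` does this for the `γ`-keyed 13.4). THIS FILE does it for the PRINT-EXACT
13.4 (`Kato2004.thm13_4_lengthAt_fineSelmerDualContra_le_of_isEulerSystemClass`, `γ⁻¹`-keyed fine datum) on the `γ⁻¹`-keyed ♯/♭
package, using w2 g12's `SharpFlatColemanKatoDataContra.fine_le_zeta_of_thm13_4` at `𝔭 = (T)` and the finiteness of the zeta index
there (`lengthAt_quotient_zeta_ne_top`, from the Néron-normalised generator — so (12.2.2) is not needed either):

* §1 (package level): `SharpFlatColemanKatoDataContra.isTorsion_fine_of_thm13_4` — **every `γ⁻¹`-keyed fine dual datum is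
  `Λ`-torsion** (Kato 12.4 (1) / Kobayashi Cor. 7.2 DERIVED on the package); `….isTorsion_inv_of_thm13_4` / `….isTorsion_of_thm13_4`
  — **every `γ⁻¹`-keyed (print) resp. `γ`-keyed (tree) dual datum of `Sel^•(E/ℚ_∞)` is `Λ`-torsion** (through the Literature's
  `isTorsion_inv_of_nontrivial` / `isTorsion_of_normalised`).
* §2 `thm714_clauses_of_thm13_4 (h134C) (hSerre) (hCKc)` — the BODY of `thm714_sharpFlatSelmerDual_finite_torsion` (finite generation:
  the tree theorem `SharpFlatSelmerDualData.moduleFinite`; torsion: §1) in its own binder telescope + (`¬CM`, `E[p]` irreducible, a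
  period ratio `ϖ` with `‖ϖ‖_p = 1`).
* §3 **`thm714_onX8_of_thm13_4 (h134C) (hSerre) (hJc) (h3) : ∀ W p, ClassX8 W p → ‹body of thm714_… at (W,p)›`** — drop-in for
  `h714 W p …` in every X8 consumer; and `fineSelmerDual_isTorsion_onX8_of_thm13_4` (both keys) — drop-in for Kato's fine torsion
  / `h124` (1) at X8 pairs.

HONEST FRAMING. Nothing is discharged: Kato 13.4, Serre's open image, the `γ⁻¹`-keyed package and the period unit are PUBLISHED
theorems typed statement-only (typed ≠ proved); the all-curves named facts (`thm714_…`, `Kato2004_fineSelmerDual_isTorsion`) are NOT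
proved here (CM curves: hypothesis (v)). Effect on the displayed trust base of the X8 print routes: together with p681309, the two
Sprung inputs `h714`, `h716c` of the K′/C′ guards and of `PublishedInputsX8Contra` are, ON X8, kernel consequences of {Kato 13.4
print-exact, Serre, package 23747, period unit 19291}. No summit statement, no K1, no K′ / C′ / MC′, no X8 cell is proved or
moved by this file.

References: F. Sprung, J. Number Theory 132 (2012) Thm. 1.2 (p. 1486), Def. 6.1 (p. 1495), Thm. 7.14 with (3) (p. 1504)
[Sprung2012]; K. Kato, Astérisque 295 (2004) §12.2, Thm. 12.4 (1) (p. 221), Thm. 13.4 (2) (p. 226), §17.13 [Kato2004Asterisque]; S.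
Kobayashi, Invent. Math. 152 (2003) Cor. 7.2, Thm. 7.3 i) (p. 13) [Kobayashi2003]; J.-P. Serre (1968) IV-11 [SerreAbelianLadic1968];
L. Washington, GTM 83 §13.2 [Washington1997]. Tree: `PrintX8VSCSharpFlatKatoDivisibilityContraOfThm134` (w3 g11, p681309),
`…IotaDoorContraOrbitKato` (w2 g12), `Sprung2012/SharpFlatSelmerTorsionOfContragredientSequenceProofs`,
`Kato2004/FineSelmerDualTorsionOfEulerSystemBoundProofs`, `KatoRankBoundProofs` (`primeT`).
-/

set_option linter.dupNamespace false
set_option autoImplicit false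

noncomputable section

open scoped Classical NumberField MatrixGroups ModularForm

open NumberField IsDedekindDomain CongruenceSubgroup WeierstrassCurve Field
  Literature.NumberTheory.EllipticCurves Literature.NumberTheory.EllipticCurves.ModularForms
  Literature.NumberTheory.EllipticCurves.ZpExtension Literature.NumberTheory.EllipticCurves.Sprung2017
  Literature.NumberTheory.EllipticCurves.Sprung2012 Literature.NumberTheory.EllipticCurves.Rank1Residual
  Literature.NumberTheory.EllipticCurves.IwasawaAlgebra Literature.NumberTheory.EllipticCurves.Kato2004
  Literature.NumberTheory.EllipticCurves.Module
  Summit.BirchSwinnertonDyer.BirchSwinnertonDyer.Theorems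
  Summit.BirchSwinnertonDyer.Rank1Residual.Supersingular

namespace Summit.BirchSwinnertonDyer.BirchSwinnertonDyer.Theorems.ChromaticCommonZeros

/-! ### §1 Package level: fine-Selmer torsion and ♯/♭ torsion from Kato 13.4 (2) at `(T)` -/

section Package

variable (W : WeierstrassCurve ℚ) [W.IsElliptic] (p : ℕ) [Fact p.Prime]
  [ContinuousSMul ℤ_[p] (W.tateModule p)] [Module.Free ℤ_[p] (W.tateModule p)]
  [Module.Finite ℤ_[p] (W.tateModule p)]
  {N : ℕ} {f : CuspForm (Gamma0 N) 2} {ϖ : ℚ} {κ : ZpExtension ℚ p} {γ : absoluteGaloisGroup ℚ}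
  {E : Type} [Field E] [Algebra ℚ E] {ι : AlgebraicClosure ℚ →ₐ[ℚ] AlgebraicClosure E} {ap : ℤ}
  {g : absoluteGaloisGroup E} {c : ℕ → localPoints W E} {I : IwasawaH1Data W p κ γ}

/-- **Kato Thm. 12.4 (1) / (17.13.1) — Kobayashi Cor. 7.2 — DERIVED on the contragredient ♯/♭ package from Kato 13.4 (2):** for a
print-keyed package `C` of colour `•` on a pinned `I` over the cyclotomic `(κ, γ)` (`p` odd, `E` non-CM, `E[p]` irreducible, `L^• ≠ 0`,
Néron-normalised `G₁ ≠ 0`), EVERY `γ⁻¹`-keyed dual datum `Y′` of the fine Selmer group `Sel₀(ℚ_∞, E[p^∞])` is `Λ`-torsion.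
Proof: at the augmentation prime `(T)` (height one, `p ∉ (T)`), Kato 13.4 (2) on the package (`fine_le_zeta_of_thm13_4`) gives
`ℓ_{(T)} Y′.X ≤ ℓ_{(T)}(I.H ⧸ C.Z)`, finite by `lengthAt_quotient_zeta_ne_top`; finite length at `(T)` forces torsion
(`IwasawaAlgebra.isTorsion_of_lengthAt_primeT_ne_top`). CONDITIONAL on `h134C`, `hSerre`.
[cite: Kato2004Asterisque, Thm. 12.4 (1) (p. 221), Thm. 13.4 (2) (p. 226), §17.13 (17.13.1) (p. 280)] [cite: Kobayashi2003, Cor. 7.2 (p. 13)]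
[cite: Sprung2012, Def. 6.1 (p. 1495), Thm. 7.14 (3) (p. 1504)] -/
theorem _root_.Literature.NumberTheory.EllipticCurves.Sprung2012.SharpFlatColemanKatoDataContra.isTorsion_fine_of_thm13_4
    (h134C : thm13_4_lengthAt_fineSelmerDualContra_le_of_isEulerSystemClass)
    (hSerre : serre_adicImage_contains_congruenceSubgroup)
    {col : Chroma} (C : SharpFlatColemanKatoDataContra W p f ϖ κ γ ι ap g c col I)
    (hp : p ≠ 2) (hκ : κ.IsCyclotomic) (hγ : κ.IsTopGenerator γ) (hCM : ¬ W.HasCM)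
    (hirr : W.HasIrreducibleModPGaloisRep p) {Lsharp Lflat G₁ : IwasawaAlgebra p}
    (hSP : IsSprungPair f p ap Lsharp Lflat) (hcol : chromaticL col Lsharp Lflat ≠ 0)
    (hG₁ : iwasawaToPowerSeries p G₁ =
      PowerSeries.C ((ϖ : ℚ) : ℚ_[p]) * iwasawaToPowerSeries p (chromaticL col Lsharp Lflat))
    (hG0 : G₁ ≠ 0) (Y : W.FineSelmerDualData κ γ⁻¹) :
    Module.IsTorsion (IwasawaAlgebra p) Y.X := by
  have hpT : (p : IwasawaAlgebra p) ∉ (IwasawaAlgebra.primeT p).asIdeal := by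
    rw [IwasawaAlgebra.primeT_asIdeal, Ideal.mem_span_singleton, ← map_natCast (PowerSeries.C (R := ℤ_[p])) p,
      PowerSeries.X_dvd_iff, PowerSeries.constantCoeff_C]
    exact_mod_cast (Fact.out : p.Prime).ne_zero
  have hle := C.fine_le_zeta_of_thm13_4 W p h134C hSerre hp hκ hγ hCM hirr hSP hcol hG₁ hG0 Y (IwasawaAlgebra.primeT p)
    (IwasawaAlgebra.height_primeT p) hpT
  have hk := C.lengthAt_quotient_zeta_ne_top W p hirr hSP hcol hG₁ hG0 (IwasawaAlgebra.primeT p)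
    (IwasawaAlgebra.height_primeT p)
  exact IwasawaAlgebra.isTorsion_of_lengthAt_primeT_ne_top Y.X (ne_top_of_le_ne_top hk hle)

/-- **Sprung Thm. 7.14 (torsion clause) for the PRINT-keyed dual, from Kato 13.4:** same package data; EVERY `γ⁻¹`-keyed dual datum
`D′` of `Sel^•(E/ℚ_∞)` is `Λ`-torsion (sequence (3): `𝐇¹ →ᶜᵒˡ Λ → D′.X → Y′.X`, `colMap` injective, `Y′` torsion by
`isTorsion_fine_of_thm13_4`, `𝐇¹ ≠ 0` from the normalised generator). CONDITIONAL on `h134C`, `hSerre`.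
[cite: Sprung2012, Thm. 1.2 (p. 1486), Thm. 7.14 with (3) (p. 1504)] [cite: Kato2004Asterisque, Thm. 13.4 (2) (p. 226)] -/
theorem _root_.Literature.NumberTheory.EllipticCurves.Sprung2012.SharpFlatColemanKatoDataContra.isTorsion_inv_of_thm13_4
    (h134C : thm13_4_lengthAt_fineSelmerDualContra_le_of_isEulerSystemClass)
    (hSerre : serre_adicImage_contains_congruenceSubgroup)
    {col : Chroma} (C : SharpFlatColemanKatoDataContra W p f ϖ κ γ ι ap g c col I)
    (hp : p ≠ 2) (hκ : κ.IsCyclotomic) (hγ : κ.IsTopGenerator γ) (hCM : ¬ W.HasCM)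
    (hirr : W.HasIrreducibleModPGaloisRep p) {Lsharp Lflat G₁ : IwasawaAlgebra p}
    (hSP : IsSprungPair f p ap Lsharp Lflat) (hcol : chromaticL col Lsharp Lflat ≠ 0)
    (hG₁ : iwasawaToPowerSeries p G₁ =
      PowerSeries.C ((ϖ : ℚ) : ℚ_[p]) * iwasawaToPowerSeries p (chromaticL col Lsharp Lflat))
    (hG0 : G₁ ≠ 0) (D' : SharpFlatSelmerDualData W κ γ⁻¹ ι ap g c col) :
    Module.IsTorsion (IwasawaAlgebra p) D'.X := by
  haveI : Nontrivial I.H := C.nontrivial_of_normalised hirr hSP hG₁ hG0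
  obtain ⟨Y⟩ := W.nonempty_fineSelmerDualData' κ γ⁻¹
  exact C.isTorsion_inv_of_nontrivial hSP hcol Y
    (C.isTorsion_fine_of_thm13_4 W p h134C hSerre hp hκ hγ hCM hirr hSP hcol hG₁ hG0 Y) D'

/-- **Sprung Thm. 7.14 (torsion clause) for the TREE-keyed dual (the named fact's binder), from Kato 13.4:** same package data;
EVERY `γ`-keyed dual datum `D` of `Sel^•(E/ℚ_∞)` is `Λ`-torsion (`isTorsion_of_normalised` fed with `isTorsion_fine_of_thm13_4`).
CONDITIONAL on `h134C`, `hSerre`. [cite: Sprung2012, Thm. 1.2 (p. 1486), Thm. 7.14 with (3) (p. 1504)]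
[cite: Kato2004Asterisque, Thm. 13.4 (2) (p. 226)] [cite: GreenbergLNM1716, §1 (p. 60)] -/
theorem _root_.Literature.NumberTheory.EllipticCurves.Sprung2012.SharpFlatColemanKatoDataContra.isTorsion_of_thm13_4
    (h134C : thm13_4_lengthAt_fineSelmerDualContra_le_of_isEulerSystemClass)
    (hSerre : serre_adicImage_contains_congruenceSubgroup)
    {col : Chroma} (C : SharpFlatColemanKatoDataContra W p f ϖ κ γ ι ap g c col I)
    (hp : p ≠ 2) (hκ : κ.IsCyclotomic) (hγ : κ.IsTopGenerator γ) (hCM : ¬ W.HasCM)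
    (hirr : W.HasIrreducibleModPGaloisRep p) {Lsharp Lflat G₁ : IwasawaAlgebra p}
    (hSP : IsSprungPair f p ap Lsharp Lflat) (hcol : chromaticL col Lsharp Lflat ≠ 0)
    (hG₁ : iwasawaToPowerSeries p G₁ =
      PowerSeries.C ((ϖ : ℚ) : ℚ_[p]) * iwasawaToPowerSeries p (chromaticL col Lsharp Lflat))
    (hG0 : G₁ ≠ 0) (D : SharpFlatSelmerDualData W κ γ ι ap g c col) :
    Module.IsTorsion (IwasawaAlgebra p) D.X := by
  obtain ⟨Y⟩ := W.nonempty_fineSelmerDualData' κ γ⁻¹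
  exact C.isTorsion_of_normalised hirr hSP hcol hG₁ hG0 Y
    (C.isTorsion_fine_of_thm13_4 W p h134C hSerre hp hκ hγ hCM hirr hSP hcol hG₁ hG0 Y) D

end Package

/-! ### §2 The body of `thm714_sharpFlatSelmerDual_finite_torsion` in its own binder telescope -/

/-- **SPRUNG 2012 THM. 1.2 / 7.14 DERIVED** — for a non-CM curve with `E[p]` irreducible and a `p`-adic unit period ratio `ϖ`
(`ϖ·Ω_E = Ω⁺_f`). In the binder telescope of the named fact `thm714_sharpFlatSelmerDual_finite_torsion` (`W/ℚ` globally minimal,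
`p ≠ 2` good with `p ∣ a_p`, newform `f`, cyclotomic `(κ, γ)`, the place `v ∣ p`, local lift `g`, Honda system `(cneg, c)`, colour `•`
with `L^• ≠ 0`, a `γ`-keyed dual datum `D` of `Sel^•(E/ℚ_∞)`): **`D.X` is finitely generated and `Λ`-torsion.** Finite generation is
the tree theorem `SharpFlatSelmerDualData.moduleFinite` (Greenberg's criterion, input-free); torsion is §1 on the package furnished by
`hCKc` (Kato's `𝐇¹` datum from `Kato2004.nonempty_iwasawaH1Data_holds`, PROVED; normalised generator `G₁ := C(ϖ)·L^•`). Inputs BY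
NAME: `h134C` (Kato 13.4 print-exact), `hSerre`, `hCKc`. [cite: Sprung2012, Thm. 1.2 (p. 1486), Def. 6.1 (p. 1495), Thm. 7.14 with (3) (p. 1504)]
[cite: Kato2004Asterisque, Thm. 13.4 (2) (p. 226)] [cite: SerreAbelianLadic1968, IV-11] [cite: GreenbergLNM1716, §1 (p. 60)] -/
theorem thm714_clauses_of_thm13_4
    (h134C : thm13_4_lengthAt_fineSelmerDualContra_le_of_isEulerSystemClass)
    (hSerre : serre_adicImage_contains_congruenceSubgroup)
    (hCKc : thm714seq_sharpFlatColemanKato_zeta_contra)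
    (W : WeierstrassCurve ℚ) [W.IsElliptic] [W.IsGloballyMinimal] (p : ℕ) [Fact p.Prime]
    (hp : p ≠ 2) (hgood : W.HasGoodReductionAtPrime p) (hss : (p : ℤ) ∣ W.frobeniusTrace p)
    (hCM : ¬ W.HasCM) (hirr : W.HasIrreducibleModPGaloisRep p)
    {N : ℕ} [NeZero N] (f : CuspForm (Gamma0 N) 2) (hf : IsNewformOf W f)
    (ϖ : ℚ) (hϖ : (ϖ : ℝ) * W.realPeriodRat = plusPeriod f) (hϖ1 : ‖((ϖ : ℚ) : ℚ_[p])‖ = 1)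
    (κ : ZpExtension ℚ p) (γ : Field.absoluteGaloisGroup ℚ)
    (hκ : κ.IsCyclotomic) (hγ : κ.IsTopGenerator γ) (hγ' : IsCyclotomicVariable p γ)
    (v : HeightOneSpectrum (𝓞 ℚ)) (hv : (p : 𝓞 ℚ) ∈ v.asIdeal)
    (g : Field.absoluteGaloisGroup (v.adicCompletion ℚ))
    (hg : κ.IsTopGenerator (resGalOfEmb (closureEmb (K := ℚ) (v.adicCompletion ℚ)) g))
    (cneg : localPoints W (v.adicCompletion ℚ)) (c : ℕ → localPoints W (v.adicCompletion ℚ))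
    (hH : IsHondaSystem κ (closureEmb (K := ℚ) (v.adicCompletion ℚ)) W (W.frobeniusTrace p) g cneg c)
    (col : Chroma) (Lsharp Lflat : IwasawaAlgebra p)
    (hSP : IsSprungPair f p (W.frobeniusTrace p) Lsharp Lflat) (hL0 : chromaticL col Lsharp Lflat ≠ 0)
    (D : SharpFlatSelmerDualData W κ γ (closureEmb (K := ℚ) (v.adicCompletion ℚ)) (W.frobeniusTrace p) g c col) :
    Module.Finite (IwasawaAlgebra p) D.X ∧ Module.IsTorsion (IwasawaAlgebra p) D.X := by
  refine ⟨D.moduleFinite hγ, ?_⟩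
  haveI : ContinuousSMul ℤ_[p] (W.tateModule p) := TateModule.continuousSMul_padicInt
  haveI : Module.Free ℤ_[p] (W.tateModule p) := W.module_free_tateModule_holds p
  haveI : Module.Finite ℤ_[p] (W.tateModule p) := W.module_finite_tateModule_holds p
  obtain ⟨I⟩ := Kato2004.nonempty_iwasawaH1Data_holds W p κ γ hκ hγ
  obtain ⟨C⟩ := hCKc W p f ϖ κ γ hp hgood hss hf hϖ hκ hγ hγ' v hv g hg cneg c hH col I
  -- the normalised generator `G₁ = C(ϖ) · L^•`, `ϖ ∈ ℤ_pˣ`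
  set a : ℤ_[p] := ⟨((ϖ : ℚ) : ℚ_[p]), hϖ1.le⟩ with ha_def
  have ha : IsUnit a := PadicInt.isUnit_iff.mpr hϖ1
  have hcoe : (a : ℚ_[p]) = ((ϖ : ℚ) : ℚ_[p]) := rfl
  set G₁ : IwasawaAlgebra p := PowerSeries.C a * chromaticL col Lsharp Lflat with hG₁_def
  have hG₁ : iwasawaToPowerSeries p G₁ =
      PowerSeries.C ((ϖ : ℚ) : ℚ_[p]) * iwasawaToPowerSeries p (chromaticL col Lsharp Lflat) := by
    rw [hG₁_def, iwasawaToPowerSeries_C_mul, hcoe]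
  obtain ⟨u, hu⟩ := (PowerSeries.C (R := ℤ_[p])).isUnit_map ha
  have hG0 : G₁ ≠ 0 := by
    rw [hG₁_def, ← hu]
    exact mul_ne_zero u.ne_zero hL0
  exact C.isTorsion_of_thm13_4 W p h134C hSerre hp hκ hγ hCM hirr hSP hL0 hG₁ hG0 D

/-! ### §3 On class X8: Sprung Thm. 7.14 and Kato's fine torsion, from four displayed facts -/

/-- **SPRUNG 2012 THM. 7.14 ON CLASS X8 IS A KERNEL CONSEQUENCE OF {KATO 13.4, SERRE, THE HELD `γ⁻¹`-KEYED JOINT PACKAGE, THE HELD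
PERIOD UNIT AT 3}.** For every X8 pair `(W, 3)`: the BODY of the named fact `thm714_sharpFlatSelmerDual_finite_torsion` at `(W, p)` —
VERBATIM its binder telescope from `p ≠ 2` on, conclusion `Module.Finite Λ D.X ∧ Module.IsTorsion Λ D.X` for every `γ`-keyed dual datum
`D` of `Sel^•(E/ℚ_∞)` with `L^• ≠ 0`. A drop-in for `h714 W p` in every X8 consumer (the K′/C′ guards, `PublishedInputsX8Contra` (iii),
`HeldInputsX8RContra` (i), the upper-half files). X8 discharges: `ClassX8.not_hasCM`, `ClassX8.irr'`, and `ϖ := u⁻¹` from the held period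
fact at `3` (`h3`, item 19291: `Ω_E = u·Ω⁺_f`, `‖u‖₃ = 1`). Inputs BY NAME: `h134C`, `hSerre`, `hJc = thm714seq_sharpFlatColemanKato_zetaJoint_contra`
(item 23747; one colour used, `…_of_joint`), `h3`. HONEST FRAMING: conditional on these four published facts (typed ≠ proved); the
all-curves named fact is NOT discharged; BSD / K′ / C′ / MC′ are not proved. [cite: Sprung2012, Thm. 1.2 (p. 1486), Thm. 7.14 with (3) (p. 1504)]
[cite: Kato2004Asterisque, Thm. 13.4 (2) (p. 226)] [cite: GreenbergVatsal2000, §3 Rem. 3.4] [cite: SerreAbelianLadic1968, IV-11] -/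
theorem thm714_onX8_of_thm13_4
    (h134C : thm13_4_lengthAt_fineSelmerDualContra_le_of_isEulerSystemClass)
    (hSerre : serre_adicImage_contains_congruenceSubgroup)
    (hJc : thm714seq_sharpFlatColemanKato_zetaJoint_contra)
    (h3 : realPeriodRat_eq_unit_mul_plusPeriod_three) :
    ∀ (W : WeierstrassCurve ℚ) [W.IsElliptic] [W.IsGloballyMinimal] (p : ℕ) [Fact p.Prime],
      ClassX8 W p →
      p ≠ 2 → W.HasGoodReductionAtPrime p → (p : ℤ) ∣ W.frobeniusTrace p →
    ∀ {N : ℕ} [NeZero N] (f : CuspForm (Gamma0 N) 2), IsNewformOf W f →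
    ∀ (κ : ZpExtension ℚ p) (γ : Field.absoluteGaloisGroup ℚ),
      κ.IsCyclotomic → κ.IsTopGenerator γ → IsCyclotomicVariable p γ →
    ∀ (v : HeightOneSpectrum (𝓞 ℚ)), (p : 𝓞 ℚ) ∈ v.asIdeal →
    ∀ (g : Field.absoluteGaloisGroup (v.adicCompletion ℚ)),
      κ.IsTopGenerator (resGalOfEmb (closureEmb (K := ℚ) (v.adicCompletion ℚ)) g) →
    ∀ (cneg : localPoints W (v.adicCompletion ℚ)) (c : ℕ → localPoints W (v.adicCompletion ℚ)),
      IsHondaSystem κ (closureEmb (K := ℚ) (v.adicCompletion ℚ)) W (W.frobeniusTrace p) g cneg c →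
    ∀ (col : Chroma) (Lsharp Lflat : IwasawaAlgebra p),
      IsSprungPair f p (W.frobeniusTrace p) Lsharp Lflat → chromaticL col Lsharp Lflat ≠ 0 →
    ∀ (D : SharpFlatSelmerDualData W κ γ (closureEmb (K := ℚ) (v.adicCompletion ℚ))
        (W.frobeniusTrace p) g c col),
      Module.Finite (IwasawaAlgebra p) D.X ∧ Module.IsTorsion (IwasawaAlgebra p) D.X := by
  intro W _ _ p _ hX hp hgood hss N _ f hf κ γ hκ hγ hγ' v hv g hg cneg c hH col Lsharp Lflat hSP hL0 D
  have hp3 : p = 3 := hX.1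
  subst hp3
  obtain ⟨u, hu, hΩ⟩ := h3 W hgood (ClassX8.irr W 3 hX) f hf
  have hu0 : u ≠ 0 := by
    rintro rfl
    rw [Rat.cast_zero, norm_zero] at hu
    exact zero_ne_one hu
  have hϖ : ((u⁻¹ : ℚ) : ℝ) * W.realPeriodRat = plusPeriod f := by
    rw [hΩ, Rat.cast_inv, ← mul_assoc, inv_mul_cancel₀ (by exact_mod_cast hu0 : (u : ℝ) ≠ 0), one_mul]
  have hϖ1 : ‖((u⁻¹ : ℚ) : ℚ_[3])‖ = 1 := by
    rw [Rat.cast_inv, norm_inv, hu, inv_one]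
  exact thm714_clauses_of_thm13_4 h134C hSerre (thm714seq_sharpFlatColemanKato_zeta_contra_of_joint hJc) W 3 hp hgood hss
    (ClassX8.not_hasCM W 3 hX) (ClassX8.irr' W 3 hX) f hf u⁻¹ hϖ hϖ1 κ γ hκ hγ hγ' v hv g hg cneg c hH col Lsharp Lflat
    hSP hL0 D

/-- **KATO'S FINE-SELMER TORSION ON CLASS X8 (both keys) from the same four facts** — drop-in for `Kato2004_fineSelmerDual_isTorsion` /
`Kato2004.thm12_4` (1) at X8 pairs: for every X8 pair `(W, 3)`, the cyclotomic `(κ, γ)`, and EVERY dual datum of `Sel₀(ℚ_∞, E[3^∞])`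
keyed by `γ⁻¹` (print) or by `γ` (tree), the dual is `Λ`-torsion. The package is instantiated at the place above `3`, a local lift,
a Honda system (Sprung Thm. 2.2, a tree theorem) and the newform of `hmodf`; colour: one with `L^• ≠ 0` (Sprung Prop. 6.14 /
`ChromaticBothColours.ClassX8.chromaticL_ne_zero`, both non-zero on X8). Inputs BY NAME: `h134C`, `hSerre`, `hJc`, `h3`, and
modularity `hmodf` (to have a newform at all). CONDITIONAL; closes nothing. [cite: Kato2004Asterisque, Thm. 12.4 (1) (p. 221), Thm. 13.4 (2) (p. 226), §17.13]
[cite: Kobayashi2003, Cor. 7.2 (p. 13)] [cite: Sprung2012, Thm. 2.2 (p. 1487), Prop. 6.14 (p. 1498), Thm. 7.14 (3) (p. 1504)] -/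
theorem fineSelmerDual_isTorsion_onX8_of_thm13_4
    (hmodf : exists_isNewformOf) (h22 : thm22_exists_isHondaSystem)
    (h134C : thm13_4_lengthAt_fineSelmerDualContra_le_of_isEulerSystemClass)
    (hSerre : serre_adicImage_contains_congruenceSubgroup)
    (hJc : thm714seq_sharpFlatColemanKato_zetaJoint_contra)
    (h3 : realPeriodRat_eq_unit_mul_plusPeriod_three)
    (W : WeierstrassCurve ℚ) [W.IsElliptic] [W.IsGloballyMinimal] (p : ℕ) [Fact p.Prime] (hX : ClassX8 W p)
    (κ : ZpExtension ℚ p) (γ : Field.absoluteGaloisGroup ℚ)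
    (hκ : κ.IsCyclotomic) (hγ : κ.IsTopGenerator γ) (hγ' : IsCyclotomicVariable p γ) :
    (∀ Y' : W.FineSelmerDualData κ γ⁻¹, Module.IsTorsion (IwasawaAlgebra p) Y'.X) ∧
      (∀ Y : W.FineSelmerDualData κ γ, Module.IsTorsion (IwasawaAlgebra p) Y.X) := by
  have hp3 : p = 3 := hX.1
  subst hp3
  have hp2 : (3 : ℕ) ≠ 2 := by decide
  have hgood : W.HasGoodReductionAtPrime 3 := ClassX8.good W 3 hX
  have hdvd : ((3 : ℕ) : ℤ) ∣ W.frobeniusTrace 3 := ClassX8.dvd_frobeniusTrace W 3 hX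
  have hirr : W.HasIrreducibleModPGaloisRep 3 := ClassX8.irr W 3 hX
  haveI : ContinuousSMul ℤ_[3] (W.tateModule 3) := TateModule.continuousSMul_padicInt
  haveI : Module.Free ℤ_[3] (W.tateModule 3) := W.module_free_tateModule_holds 3
  haveI : Module.Finite ℤ_[3] (W.tateModule 3) := W.module_finite_tateModule_holds 3
  -- the newform, Sprung's pair (Sprung 2017 Thm. 1.12), a non-zero colour
  haveI : NeZero (W.conductorNorm ℤ) := ⟨(W.conductorNorm_pos_holds).ne'⟩
  obtain ⟨f, hf⟩ := hmodf W
  obtain ⟨Lsharp, Lflat, hSP⟩ :=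
    thm112_exists_isSprungPair_holds (W := W) (f := f) (p := 3) hp2 hf hgood hdvd
  have hs : chromaticL Chroma.sharp Lsharp Lflat ≠ 0 :=
    ChromaticBothColours.ClassX8.chromaticL_ne_zero W 3 hX f Lsharp Lflat hf hSP Chroma.sharp
  -- the place above `3`, a local lift of `γ`, a Honda system (Thm. 2.2)
  obtain ⟨v, hv⟩ :=
    Literature.NumberTheory.NumberFields.RingOfIntegers.exists_heightOneSpectrum_natCast_mem ℚ
      (p := 3) (by norm_num)
  obtain ⟨g, hg⟩ := ZpExtension.IsCyclotomic.exists_isTopGenerator_resGalOfEmb_adicCompletion hκ v hv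
  obtain ⟨cneg, c, hc⟩ := h22 W 3 hp2 hgood hdvd κ γ hκ hγ hγ' v hv g hg
  -- the period ratio and the normalised generator
  obtain ⟨u, hu, hΩ⟩ := h3 W hgood hirr f hf
  have hu0 : u ≠ 0 := by
    rintro rfl
    rw [Rat.cast_zero, norm_zero] at hu
    exact zero_ne_one hu
  have hϖ : ((u⁻¹ : ℚ) : ℝ) * W.realPeriodRat = plusPeriod f := by
    rw [hΩ, Rat.cast_inv, ← mul_assoc, inv_mul_cancel₀ (by exact_mod_cast hu0 : (u : ℝ) ≠ 0), one_mul]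
  have hϖ1 : ‖((u⁻¹ : ℚ) : ℚ_[3])‖ = 1 := by
    rw [Rat.cast_inv, norm_inv, hu, inv_one]
  set a : ℤ_[3] := ⟨((u⁻¹ : ℚ) : ℚ_[3]), hϖ1.le⟩ with ha_def
  have ha : IsUnit a := PadicInt.isUnit_iff.mpr hϖ1
  have hcoe : (a : ℚ_[3]) = ((u⁻¹ : ℚ) : ℚ_[3]) := rfl
  set G₁ : IwasawaAlgebra 3 := PowerSeries.C a * chromaticL Chroma.sharp Lsharp Lflat with hG₁_def
  have hG₁ : iwasawaToPowerSeries 3 G₁ =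
      PowerSeries.C (((u⁻¹ : ℚ) : ℚ) : ℚ_[3]) * iwasawaToPowerSeries 3 (chromaticL Chroma.sharp Lsharp Lflat) := by
    rw [hG₁_def, iwasawaToPowerSeries_C_mul, hcoe]
  obtain ⟨w, hw⟩ := (PowerSeries.C (R := ℤ_[3])).isUnit_map ha
  have hG0 : G₁ ≠ 0 := by
    rw [hG₁_def, ← hw]
    exact mul_ne_zero w.ne_zero hs
  -- Kato's `𝐇¹` datum and the ♯-package in print keying
  obtain ⟨I⟩ := Kato2004.nonempty_iwasawaH1Data_holds W 3 κ γ hκ hγ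
  obtain ⟨C⟩ := thm714seq_sharpFlatColemanKato_zeta_contra_of_joint hJc W 3 f u⁻¹ κ γ hp2 hgood hdvd hf hϖ hκ hγ hγ' v hv g hg
    cneg c hc Chroma.sharp I
  have hY' : ∀ Y' : W.FineSelmerDualData κ γ⁻¹, Module.IsTorsion (IwasawaAlgebra 3) Y'.X := fun Y' =>
    C.isTorsion_fine_of_thm13_4 W 3 h134C hSerre hp2 hκ hγ (ClassX8.not_hasCM W 3 hX) hirr hSP hs hG₁ hG0 Y'
  refine ⟨hY', fun Y => ?_⟩
  obtain ⟨Y'⟩ := W.nonempty_fineSelmerDualData' κ γ⁻¹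
  exact (fineSelmerDualData_isTorsion_inv_iff Y Y').mpr (hY' Y')

end Summit.BirchSwinnertonDyer.BirchSwinnertonDyer.Theorems.ChromaticCommonZeros

end
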